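import Summits.BirchSwinnertonDyer.BirchSwinnertonDyer.Theorems.ClassRecordThreeCornerAtThreeBranchesDefs
import Literature.NumberTheory.EllipticCurves.GlobalMinimalModelProofs
import HarnessLib

/-!
# Crux `CornerAtThree` (item stmt-BirchSwinnertonDyer-19111; routes `ClassRecordThree` ∕ `KolyvaginRoadThree`),
# conjunct 3: the CONVERSE BRIDGE — the consumer shape gives back the typed conjunct, modulo conjunct 2
# (cell `bsd-stepL`, seat `bsd-stepL-corner3-p2` g4 = WIDTH-LEVER lane B; planner g36 RULING 31 (A);
# `--supports stmt-BirchSwinnertonDyer-19111 --as helper`)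

HONEST FRAMING: THEOREMS ONLY (no definition, no named fact, no `sorry`); every theorem is CONDITIONAL on
its displayed binders; nothing here is a BSD class theorem; no census label moves (T7); item 19111 is NOT
closed and its registered stub `stub_cornerUpper3` (`Theorems.CornerAtThreeUpper` = `∀ W, Three.CornerUpperAt W`)
is NOT proved. BSD is not proved by any of this.

WHY (planner g36 RULING 31 (A), answering lane B g3's memo CORNER3-G3 §4 «conjunct 3 AS TYPED is STRONGER
than what the route consumes»): the route's kernel (`ClassRecordThreeKernelUpper.lean`) consumes conjunct 3
of the corner, `Three.CornerUpperAt W` (the Tamagawa-SHARP Kolyvagin bound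
`ord₃ #Ш(E/K) + 2·ord₃ ∏_ℓ c_ℓ(E) ≤ 2·ord₃ [E(K):ℤP]` at EVERY odd-`d_K` Manin-good Heegner datum), only
through the ℚ-level Euler-system half `ClassX11b W 3 → ¬ Surj W 3 → 3 ∣ ∏c → Typed.MissingUpperBoundAt W 3`
(x11b3-p8's bridge `Three.missingUpperBoundAt_of_cornerUpperAt`, which also uses conjunct 2
`Three.CornerTwistAt W`). THIS FILE proves the CONVERSE: the consumer shape, together with conjunct 2 and the
named print {Gross–Zagier, Kolyvagin, Gross–Zagier–Kolyvagin over ℚ, modularity}, gives back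
`Three.CornerUpperAt W` at every datum its binder hands us — so the two shapes are EQUIVALENT modulo conjunct 2
(which every line of 19111 already carries: `stub_cornerTwistLower3` ∕ `stub_cornerTwistMuAn3` ∕
`stub_cornerFacts3` ⊢ `∀ W, CornerTwistAt W`), and g3's «excess strength = the IMC-grade multi-carrier part»
is NIL modulo conjunct 2. Consequence recorded by the planner: the crux text, its ideas, its lines and both
routes' `closes` stand UNCHANGED (no restate).

THE ARITHMETIC. multr1-p2's core `X11b.exists_shaAn_padicVal_eq_of_heegner` (`X11b/BDPRouteShaAn.lean`) is
an EQUALITY at an ARBITRARY odd Heegner datum with `3 ∤ c(Dt)`, `3 ∤ #𝓞_K^×`: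
`v(q) + v(q_d) + v(∏c_W) + 2·v(t_d) = 2·v(I)` with `#Ш(E)_an = q`, `q_d = L(E^{d_K},1)/Ω_d`,
`I = [E(K):ℤP]`, and `v(Ш_K) = v(Ш_W) + v(Ш_d)`. The consumer shape says `v(Ш_W) ≤ v(q)` (the rational
`q` with `shaAn W = q` is unique); conjunct 2 (`BSDp Wd 3` for the globally minimal twist model
`Wd = Cd • E^{(d_K)}`, `hasGlobalMinimalModel_rat_holds`) gives the twist's rank-`0` `3`-part EXACTLY,
`v(q_d) = v(Ш_d) + v(∏c_d) − 2·v(t_d)` (`Three.pPartRankZero_of_cornerTwistAt`); the transports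
`v(∏c_d) = v(∏c_W)` (`X2.padicValNat_tamagawaProduct_twist_of_heegner_of_odd`) and `v(u(Cd)) = 0`
(`X11b.padicValRat_u_eq_zero_of_twist_minimal`) are theorems, and the side conditions `3 ∤ d_K`,
`3 ∤ #𝓞_K^×` hold at EVERY Heegner field because `3 ∣ N` splits in `K`
(`Three.not_dvd_discr_and_not_dvd_torsionOrder_of_heegner`). Hence
`v(Ш_K) + 2·v(∏c_W) = v(Ш_W) + v(Ш_d) + 2·v(∏c_W) ≤ v(q) + v(Ш_d) + 2·v(∏c_W) = 2·v(I)` — `omega`.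

* `Three.cornerUpperAt_of_missingUpperBoundAt_of_cornerTwistAt` — the converse bridge (RULING 31 (A) turnkey
  signature verbatim).
* `Three.cornerUpperAt_iff_missingUpperBoundAt_of_cornerTwistAt` — the EQUIVALENCE modulo conjunct 2 and the
  named print of both directions (forward = x11b3-p8's `Three.missingUpperBoundAt_of_cornerUpperAt`, whose
  extra print binders `hnf`, `hHL`, `hMaz` supply ONE odd Manin-good datum).
* `cornerAtThreeUpper_of_consumed_of_twist` — class level: `Theorems.CornerAtThreeUpper` (the registered
  reading of `stub_cornerUpper3`, = `∀ W, Three.CornerUpperAt W`) ⟸ {the consumer shape at every corner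
  curve, `∀ W, Three.CornerTwistAt W`, named print}.

References: [JetchevSkinnerWan2017] §7.4.1 (eq:gz for K′), §7.4.2 (eq:shaupper), pp. 29–31 of
arXiv:1512.06894; [GrossLMS1991] §2 (2.2); [Miller2011LMS] Def. 1.1; planner g36 RULING 31 (cell STATUS
2026-08-27T17:36:33Z); memo CORNER3-G3.md §4 ∕ §6 (evidence #53 on 19111).
-/

noncomputable section

open scoped Classical

open WeierstrassCurve NumberField IsDedekindDomain Literature.NumberTheory.EllipticCurves
  Rat.HeightOneSpectrum
  Literature.NumberTheory.EllipticCurves.ModularForms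
  Literature.NumberTheory.EllipticCurves.Rank1Residual
  Literature.NumberTheory.EllipticCurves.Rank1Residual.Typed
  Literature.NumberTheory.QuadraticFields.Quadratic
  Literature.NumberTheory.Automorphic
  Summit.BirchSwinnertonDyer.Rank1Residual
  Summit.BirchSwinnertonDyer.Rank1Residual.X11b

-- the cell's Theorems namespace repeats the summit name (Summit.<Summit>.<Problem>), as in every sibling file
set_option linter.dupNamespace false

namespace Summit.BirchSwinnertonDyer.BirchSwinnertonDyer.Theorems

/-! ### §1. Datum level: the converse bridge -/

/-- **The converse bridge (planner g36 RULING 31 (A)): the consumer shape of conjunct 3 gives back the typed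
conjunct `Three.CornerUpperAt W`, modulo conjunct 2.** For `W/ℚ` globally minimal with `(E,3) ∈` X11b and
`ρ̄_{E,3}` NOT surjective, granted conjunct 2 `Three.CornerTwistAt W` (`BSD(E^{d_K},3)` for every globally
minimal model of a Heegner twist) and the ℚ-level Euler-system half on `3 ∣ ∏_ℓ c_ℓ(E)`
(`hUB : 3 ∣ ∏c → Typed.MissingUpperBoundAt W 3`, i.e. `ord₃ #Ш(E/ℚ) ≤ ord₃ #Ш(E)_an`), the Tamagawa-SHARP
bound `ord₃ #Ш(E/K) + 2·ord₃ ∏_ℓ c_ℓ(E) ≤ 2·ord₃ [E(K):ℤP]` holds at EVERY odd-`d_K` Heegner datum with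
`3 ∤ c(Dt)` — read at the datum the binder hands us, not at a chosen one. Proof: multr1-p2's EXACT identity
`X11b.exists_shaAn_padicVal_eq_of_heegner` (`v(q) + v(q_d) + v(∏c_W) + 2v(t_d) = 2v(I)`,
`v(Ш_K) = v(Ш_W) + v(Ш_d)`) at that datum, the twist's exact rank-`0` `3`-part from conjunct 2
(`Three.pPartRankZero_of_cornerTwistAt` on `Wd = Cd • E^{(d_K)}`, `hasGlobalMinimalModel_rat_holds`), the
transports `v(∏c_d) = v(∏c_W)`, `v(u) = 0`, the side conditions `3 ∤ d_K`, `3 ∤ #𝓞_K^×` from `3 ∣ N`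
(`Three.not_dvd_discr_and_not_dvd_torsionOrder_of_heegner`), uniqueness of the rational `#Ш_an`, and `omega`.
PUBLISHED binders `hGZ`, `hKo`, `hGZK`, `hmod`. CONDITIONAL on `hTw` and `hUB`; nothing booked; closes
nothing. [cite: JetchevSkinnerWan2017, §7.4.1 (eq:gz for K′) and §7.4.2 (eq:shaupper), pp. 29–31]
[cite: GrossLMS1991, §2 Conj. (2.2) (shape)] [cite: Miller2011LMS, Def. 1.1] -/
theorem Three.cornerUpperAt_of_missingUpperBoundAt_of_cornerTwistAt [Fact (Nat.Prime 3)]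
    (hGZ : ∀ (N : ℕ) [NeZero N] (W : WeierstrassCurve ℚ) (K : Type) [Field K] [NumberField K],
      gross_zagier N W K)
    (hKo : ∀ (N : ℕ) [NeZero N] (W : WeierstrassCurve ℚ) (K : Type) [Field K] [NumberField K],
      kolyvagin N W K)
    (hGZK : rank_eq_analyticRank_of_analyticRank_le_one) (hmod : hasEntireLFunction_rat)
    (W : WeierstrassCurve ℚ) [W.IsElliptic] [W.IsGloballyMinimal]
    (hX : ClassX11b W 3) (hns : ¬ Surj W 3) (hTw : Three.CornerTwistAt W)
    (hUB : 3 ∣ W.tamagawaProduct → Typed.MissingUpperBoundAt W 3) :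
    Three.CornerUpperAt W := by
  intro N _ K _ _ Dt H ι P _ _ ht hN hK hodd hHN hLt hP hc _ _
  obtain ⟨hr, hp2, hmult, _⟩ := id hX
  -- the consumer shape: `ord₃ #Ш(E/ℚ) ≤ ord₃ q'` with `#Ш(E)_an = q'`
  obtain ⟨q', hq', hle⟩ := hUB ht
  -- `3 ∣ N`, so `3` splits in `K`: `3 ∤ d_K`, `3 ∤ #𝓞_K^×`
  have hpN : 3 ∣ W.conductorNorm ℤ :=
    (W.dvd_conductorNorm_iff_not_hasGoodReductionAtPrime 3).mpr
      (WeierstrassCurve.HasMultiplicativeReduction.not_hasGoodReduction (R := ℤ_[3]) hmult)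
  have hHNW : SatisfiesHeegnerHypothesis (W.conductorNorm ℤ) K := by rw [hN]; exact hHN
  obtain ⟨hpd, hμ⟩ := Three.not_dvd_discr_and_not_dvd_torsionOrder_of_heegner (p := 3) hK hHNW
    (by decide) hpN
  -- a globally minimal model of the twist by `d_K`, differing from the twisted equation by a `3`-unit
  have hD0 : (NumberField.discr K : ℚ) ≠ 0 := by exact_mod_cast NumberField.discr_ne_zero K
  haveI hEt : (W.quadraticTwist (NumberField.discr K : ℚ)).IsElliptic :=
    W.isElliptic_quadraticTwist hD0
  obtain ⟨Cd, hCd⟩ := hasGlobalMinimalModel_rat_holds (W.quadraticTwist (NumberField.discr K : ℚ))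
  haveI : (Cd • W.quadraticTwist (NumberField.discr K : ℚ)).IsGloballyMinimal := hCd
  set Wd : WeierstrassCurve ℚ := Cd • W.quadraticTwist (NumberField.discr K : ℚ) with hWd_def
  have hWd : Cd • W.quadraticTwist (NumberField.discr K : ℚ) = Wd := rfl
  have hu : padicValRat 3 (Cd.u : ℚ) = 0 :=
    padicValRat_u_eq_zero_of_twist_minimal W 3 K hK hHNW hmult Cd hWd
  have htam : padicValNat 3 Wd.tamagawaProduct = padicValNat 3 W.tamagawaProduct :=
    X2.padicValNat_tamagawaProduct_twist_of_heegner_of_odd W 3 hp2 K hK hodd hpd hHNW Cd hWd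
  -- conjunct 2: the twist's rank-`0` `3`-part, EXACT
  obtain ⟨qd, hqd, hvqd⟩ :=
    Three.pPartRankZero_of_cornerTwistAt hmod hGZK W hX hns hTw K Wd Cd hK hodd hHNW hLt hWd
  -- the exact Gross–Zagier bookkeeping identity at THIS datum
  obtain ⟨-, -, hsha, q, hq, hval⟩ := exists_shaAn_padicVal_eq_of_heegner W 3 N K Dt H ι P
    (hGZ N W K) (hKo N W K) hGZK hmod hK hHN hP hp2 hc hμ hr hLt Wd Cd hWd hu qd hqd
  -- the rational `#Ш_an` is unique
  have hqq : q' = q := by exact_mod_cast hq'.symm.trans hq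
  subst hqq
  have e2 : (padicValNat 3 (W.baseChange K).shaOrder : ℤ) =
      padicValNat 3 W.shaOrder + padicValNat 3 Wd.shaOrder := by exact_mod_cast hsha
  have e3 : (padicValNat 3 Wd.tamagawaProduct : ℤ) = padicValNat 3 W.tamagawaProduct := by
    exact_mod_cast htam
  have e4 : (padicValNat 3 (W.baseChange K).shaOrder : ℤ) + 2 * padicValNat 3 W.tamagawaProduct ≤
      2 * padicValNat 3 (AddSubgroup.zmultiples P).index := by omega
  exact_mod_cast e4

/-- **EQUIVALENCE of the typed conjunct 3 and its consumer shape, modulo conjunct 2 and named print.** For a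
corner curve (`(E,3) ∈` X11b, `ρ̄_{E,3}` not onto) carrying conjunct 2 `Three.CornerTwistAt W`:
`Three.CornerUpperAt W ↔ (3 ∣ ∏c → Typed.MissingUpperBoundAt W 3)`. Forward = x11b3-p8's
`Three.missingUpperBoundAt_of_cornerUpperAt` (at ONE odd Manin-good Heegner datum supplied by the print
binders `hnf` newforms, `hHL` Hoffstein–Luo, `hMaz` Mazur's Manin constant); backward =
`Three.cornerUpperAt_of_missingUpperBoundAt_of_cornerTwistAt`. So lane B g3's «excess strength of the typed
conjunct» (CORNER3-G3 §4 (a)) is NIL modulo conjunct 2 (planner g36 RULING 31 (A)). CONDITIONAL on `hTw`;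
nothing booked. [cite: JetchevSkinnerWan2017, §7.4.2 (eq:shaupper), p. 31] [cite: HoffsteinLuo1997, Theorem (§1)]
[cite: Mazur1978, Cor. 4.1] [cite: Miller2011LMS, Def. 1.1] -/
theorem Three.cornerUpperAt_iff_missingUpperBoundAt_of_cornerTwistAt [Fact (Nat.Prime 3)]
    (hGZ : ∀ (N : ℕ) [NeZero N] (W : WeierstrassCurve ℚ) (K : Type) [Field K] [NumberField K],
      gross_zagier N W K)
    (hKo : ∀ (N : ℕ) [NeZero N] (W : WeierstrassCurve ℚ) (K : Type) [Field K] [NumberField K],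
      kolyvagin N W K)
    (hGZK : rank_eq_analyticRank_of_analyticRank_le_one) (hmod : hasEntireLFunction_rat)
    (hnf : exists_isNewformOf) (hHL : HoffsteinLuo1997_exists_twist_L_one_ne_zero)
    (hMaz : mazur_not_dvd_maninConstant_of_odd)
    (W : WeierstrassCurve ℚ) [W.IsElliptic] [W.IsGloballyMinimal]
    (hX : ClassX11b W 3) (hns : ¬ Surj W 3) (hTw : Three.CornerTwistAt W) :
    Three.CornerUpperAt W ↔ (3 ∣ W.tamagawaProduct → Typed.MissingUpperBoundAt W 3) :=
  ⟨fun hU ht ↦ Three.missingUpperBoundAt_of_cornerUpperAt hGZ hKo hGZK hmod hnf hHL hMaz W hX hns ht hU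
      hTw,
    fun hUB ↦ Three.cornerUpperAt_of_missingUpperBoundAt_of_cornerTwistAt hGZ hKo hGZK hmod W hX hns
      hTw hUB⟩

/-! ### §2. Class level: the registered reading of `stub_cornerUpper3` from the consumer shape -/

/-- **Class level: `Theorems.CornerAtThreeUpper` (= `∀ W, Three.CornerUpperAt W`, the registered reading of
`stub_cornerUpper3` of crux `CornerAtThree`) from its CONSUMER shape at every corner curve, conjunct 2 at
class level (`∀ W, Three.CornerTwistAt W`, which the registered twist stubs of every line of 19111 derive via
`X11b.cornerTwistAt_of_lowerTwists_of_katoFacts_of_muAn`) and the named print {Gross–Zagier, Kolyvagin, GZK, modularity}.**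
Bookkeeping over
`Three.cornerUpperAt_of_missingUpperBoundAt_of_cornerTwistAt`; with the route kernel's forward line this makes
the two class-level shapes interchangeable for every line of 19111 (planner g36 RULING 31 (A): no restate of
the crux). CONDITIONAL on both displayed class-level inputs; closes nothing.
[cite: JetchevSkinnerWan2017, §7.4.2 (eq:shaupper), p. 31] [cite: Miller2011LMS, Def. 1.1] -/
theorem cornerAtThreeUpper_of_consumed_of_twist [Fact (Nat.Prime 3)]
    (hGZ : ∀ (N : ℕ) [NeZero N] (W : WeierstrassCurve ℚ) (K : Type) [Field K] [NumberField K],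
      gross_zagier N W K)
    (hKo : ∀ (N : ℕ) [NeZero N] (W : WeierstrassCurve ℚ) (K : Type) [Field K] [NumberField K],
      kolyvagin N W K)
    (hGZK : rank_eq_analyticRank_of_analyticRank_le_one) (hmod : hasEntireLFunction_rat)
    (hTwist : ∀ (W : WeierstrassCurve ℚ) [W.IsElliptic] [W.IsGloballyMinimal], Three.CornerTwistAt W)
    (hU : ∀ (W : WeierstrassCurve ℚ) [W.IsElliptic] [W.IsGloballyMinimal],
      ClassX11b W 3 → ¬ Surj W 3 → 3 ∣ W.tamagawaProduct → Typed.MissingUpperBoundAt W 3) :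
    CornerAtThreeUpper := by
  intro W _ _
  by_cases hX : ClassX11b W 3
  · by_cases hns : ¬ Surj W 3
    · exact Three.cornerUpperAt_of_missingUpperBoundAt_of_cornerTwistAt hGZ hKo hGZK hmod W hX hns
        (hTwist W) (hU W hX hns)
    · intro N _ K _ _ Dt H ι P _ hns' _ _ _ _ _ _ _ _ _ _
      exact absurd hns' hns
  · intro N _ K _ _ Dt H ι P hX' _ _ _ _ _ _ _ _ _ _ _
    exact absurd hX' hX

end Summit.BirchSwinnertonDyer.BirchSwinnertonDyer.Theorems

end
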